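import Summits.ResolutionOfSingularities.ResolutionOfSingularities.Theorems.HilbertSamuelEliminationSigmaMaxModificationsCorridor3TameWildDefs
import HarnessLib

/-!
# Route `HilbertSamuelElimination`, crux `SigmaMaxModificationsCorridor3`
# (stmt-ResolutionOfSingularities-19249; child of `SigmaMaxModifications` stmt-…-18506),
# helper programme H1 / H1′ / H1″ of chain w42 — definitions

[OURS · L1 W4.2] The one definition of the typed helper programme for `stub_tameNu3`
(crux planner res-L1-w42-plan-1, `run/shared/lean/pub/res-hironaka/L/w42/CRUX-PLAN.md` §2 and the
scratch file `L/w42/helpers-v1.lean`), made importable from `Theorems/` so that the helpers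
H1 (`stub_H1_hypersurface_of_hilbertFun`, Hilbert-function rigidity of hypersurfaces), H1′
(`stub_H1_hilbertFun_quotient_span_singleton`) and H1″ (`stub_H1_hilbertFun_stalk_of_mem_hsStratum`)
can be stated and landed against the tree. The body is copied VERBATIM from `helpers-v1.lean`.
NOT a statement of any manuscript.

* `hypersurfaceHFe e m` — the Hilbert function `H^{(0)}` of a hypersurface singularity of
  multiplicity `m` in embedding dimension `e ≥ 1`:
  `n ↦ C(n+e-1, e-1) - [m ≤ n]·C(n-m+e-1, e-1)` (forms of degree `n` in `e` variables modulo the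
  multiples of one form of degree `m`); `hypersurfaceHFe 4 = TameWild.hypersurfaceHF`
  (`hypersurfaceHFe_four`). For `e = 0` the formula is junk (never used).

## Sources

* V. Cossart, U. Jannsen, S. Saito, LNM 2270 (2020): §2.2 (p. 27, the functions `H^{(t)}`),
  Def. 2.13 (`Φ^{(t)}`), Def. 2.28, Thm. 2.3. [CossartJannsenSaito2020]
-/

set_option linter.dupNamespace false -- mandated namespace of this single-conjunct summit

noncomputable section

open Summit.ResolutionOfSingularities.ResolutionOfSingularities.Theorems.SigmaMaxModificationsCorridor3.TameWild

namespace Summit.ResolutionOfSingularities.ResolutionOfSingularities.Theorems.SigmaMaxModificationsCorridor3.Helpers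

/-- **Hilbert function `H^{(0)}` of a hypersurface singularity of multiplicity `m` in embedding
dimension `e ≥ 1`:** `n ↦ C(n+e-1, e-1) - [n ≥ m]·C(n-m+e-1, e-1)` (`= Φ^{(e)}(n) - Φ^{(e)}(n - m)`,
forms of degree `n` in `e` variables modulo the multiples of one form of degree `m`). Verbatim the
chain planner's `hypersurfaceHFe` (`L/w42/helpers-v1.lean`); `hypersurfaceHFe 4 m = hypersurfaceHF m`.
[cite: CossartJannsenSaito2020, Def. 2.13, Thm. 2.3] -/
def hypersurfaceHFe (e m : ℕ) : ℕ → ℕ := fun n =>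
  (n + e - 1).choose (e - 1) - if m ≤ n then (n - m + e - 1).choose (e - 1) else 0

/-- Unfolding `hypersurfaceHFe`. [cite: CossartJannsenSaito2020, Def. 2.13] -/
theorem hypersurfaceHFe_apply (e m n : ℕ) :
    hypersurfaceHFe e m n =
      (n + e - 1).choose (e - 1) - if m ≤ n then (n - m + e - 1).choose (e - 1) else 0 :=
  rfl

/-- **`hypersurfaceHFe 4 = hypersurfaceHF`**: in embedding dimension `4` the general formula is
the line's `TameWild.hypersurfaceHF m = fun n => C(n+3, 3) - C(n+3-m, 3)` (for `n < m` the
subtracted binomial vanishes). [cite: CossartJannsenSaito2020, Thm. 2.3] -/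
theorem hypersurfaceHFe_four (m : ℕ) : hypersurfaceHFe 4 m = hypersurfaceHF m := by
  funext n
  simp only [hypersurfaceHFe, hypersurfaceHF]
  have h3 : n + 4 - 1 = n + 3 := by omega
  rw [h3]
  split_ifs with h
  · have h4 : n - m + 4 - 1 = n + 3 - m := by omega
    rw [h4]
  · rw [Nat.choose_eq_zero_of_lt (by omega : n + 3 - m < 3)]

end Summit.ResolutionOfSingularities.ResolutionOfSingularities.Theorems.SigmaMaxModificationsCorridor3.Helpers

end
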